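import Literature.Computability.QuantumComplexity.ExpansionCodeFP
import Literature.Computability.QuantumComplexity.JonesInBQP
import Literature.Computability.Cryptography.QuantumCircuitDescFP
import Literature.Computability.Complexity.PromiseProofs
import HarnessLib

/-!
# QSIM over the sign basis Karp-reduces to the Jones approximation at the fifth root of unity

Topic `Literature/Computability/QuantumComplexity`. The assembly of the `PromiseBQP`-hardness of
the Jones polynomial at `k = 5` (Aharonov–Arad 2011, Thm. 3.1 with §3–§4; Freedman–Larsen–Wang
2002): the instance map sends an `n`-qubit circuit over `{H, Z, CZ, CCZ}` (QSIM, `QSimSign.lean`,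
thresholds `A_Q ≥ 3/5` / `|A_Q| ≤ 1/100`) to the raw AJL instance
`⟨4n, b, θ = 3/10, prec = 4⟩` whose braid word `b` on `4n` strands is the compiled, routed,
four-strand-encoded simulation of the circuit (`reductionBraid`, numeral form `reductionWordNat`);
the map is typed polynomial time (`instanceMap_codeFP`, from `reductionWordNatB_codeFP`) and maps
yes/no instances to yes/no instances (`instanceMap_yes`, `instanceMap_no`, from
`ratio_ge_of_isYes_compiled` / `ratio_le_of_isNo_compiled`: normalised Jones value `≥ 11/20`
resp. `≤ 3/10`), whence **`qSimSign_polyTimeReducible_jonesApprox`** and, by transitivity with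
the `PromiseBQP`-hardness of QSIM over the sign basis (`AaronsonAmbainis2018_lemma24_sign_hard`,
Aaronson–Ambainis Lemma 24, the open upstream fact), **`flw_jonesApproxProblem_hard_of_sign_hard`**.

## References

* D. Aharonov, I. Arad, *The BQP-hardness of approximating the Jones polynomial*, New J. Phys. 13
  (2011) 035019, Thm. 1.1, Thm. 3.1, §3–§4 [AharonovArad2011].
* M. Freedman, M. Larsen, Z. Wang, Comm. Math. Phys. 227 (2002) 605–622 [FreedmanLarsenWang2002].
* S. Aaronson, A. Ambainis, SIAM J. Comput. 47 (2018), §6 Lemma 24 [AaronsonAmbainis2018].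
-/

noncomputable section

namespace Literature.Computability.QuantumComplexity

open Literature.Computability.Complexity Literature.Computability.Complexity.CodeFP Cryptography ExactCompiler _root_.Computability

/-! ### Codes of the two problems -/

/-- The code of a QSIM instance is the typed code of `(1ⁿ, items of the gate list)`. [folklore] -/
theorem encode_qSimSign (I : QSimSignInstance) : I.encode = pairE unE (rawE gateE) (I.n, items I.circuit.gates) := by
  rw [QSimSignInstance.encode, QCircuit.encode_eq_encList, pairE_apply, rawE_items]; rfl

/-- The typed code of raw Jones instances. [folklore] -/
abbrev jonesE : RawJonesInstance → List Bool := pairE natE (pairE (listE genE) (pairE natE (pairE natE unE)))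

/-- The library encoding of raw Jones instances is the typed code. [folklore] -/
theorem encode_jones (x : RawJonesInstance) : RawJonesInstance.encoding.encode x = jonesE x := by
  change (encodingNatBool.pairBool ((encodingNatBool.pairBool encodingBoolBool).listBool.pairBool
    (encodingNatBool.pairBool (encodingNatBool.pairBool unaryEncodingNat)))).encode x = _
  rw [pairE_eq, pairE_eq, listE_eq, pairE_eq, pairE_eq, pairE_eq, natE_eq, bitE_eq, unE_eq]

/-! ### The instance map -/

/-- **The instance map** on `(n, items)`: the trivial yes-instance for `n = 0` (there are no
gates on no wires), else `⟨4n, word, 3, 10, 4⟩`. [cite: AharonovArad2011, Thm. 3.1] -/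
def instanceMapB (P : CompilerParams) (t : ℕ × List GItem) : RawJonesInstance :=
  if t.1 = 0 then (4, [], 3, 10, 4) else (t.1 * 4, reductionWordNatB P t.1 t.2, 3, 10, 4)

/-- The instance map on instances. [cite: AharonovArad2011, Thm. 3.1] -/
def instanceMap (P : CompilerParams) (I : QSimSignInstance) : RawJonesInstance := instanceMapB P (I.n, items I.circuit.gates)

/-- **The instance map is typed polynomial time.** [cite: AharonovArad2011, Thm. 3.1 (the reduction is polynomial)] -/
theorem instanceMapB_codeFP {P : CompilerParams} (hP : P.Good) : CodeFP (pairE unE (rawE gateE)) jonesE (instanceMapB P) := by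
  have hn : CodeFP (pairE unE (rawE gateE)) natE (fun t => t.1) := natOfUn.comp (fst _ _)
  have htest : CodeFP (pairE unE (rawE gateE)) bitE (fun t => decide (t.1 = 0)) := by exact (natEq.comp (hn.pair (const _ 0)) :)
  have hN : CodeFP (pairE unE (rawE gateE)) natE (fun t => t.1 * 4) := by exact (natMul.comp (hn.pair (const _ 4)) :)
  have hw : CodeFP (pairE unE (rawE gateE)) (listE genE) (fun t => reductionWordNatB P t.1 t.2) := (listOfRaw genE).comp (reductionWordNatB_codeFP hP)
  have htail : CodeFP (pairE unE (rawE gateE)) (pairE natE (pairE natE unE)) (fun _ => ((3 : ℕ), ((10 : ℕ), (4 : ℕ)))) := const _ _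
  have helse : CodeFP (pairE unE (rawE gateE)) jonesE (fun t => (t.1 * 4, reductionWordNatB P t.1 t.2, 3, 10, 4)) := hN.pair (hw.pair htail)
  exact (htest.ite (const _ (4, [], 3, 10, 4)) helse).congr fun t => by unfold instanceMapB; simp only [decide_eq_true_eq]

/-- **The instance map is computed on codes by an `FP` function.** [cite: AharonovArad2011, Thm. 3.1] -/
theorem instanceMap_codeFP {P : CompilerParams} (hP : P.Good) :
    ∃ f ∈ FP, ∀ I : QSimSignInstance, f I.encode = RawJonesInstance.encoding.encode (instanceMap P I) := by
  obtain ⟨f, hf, hfg⟩ := instanceMapB_codeFP hP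
  exact ⟨f, hf, fun I => by rw [encode_qSimSign, hfg, encode_jones]; rfl⟩

/-! ### Correctness -/

/-- There are no placed gates of the sign basis on no wires. [folklore] -/
theorem qGate_zero_elim (g : QGate hSign 0) : False := by
  rcases g with ⟨g, e⟩ | ⟨k, e⟩
  · rcases g with _ | _ | _ | _
    · exact (e ⟨0, by decide⟩).elim0
    · exact (e ⟨0, by decide⟩).elim0
    · exact (e ⟨0, by decide⟩).elim0
    · exact (e ⟨0, by decide⟩).elim0
  · exact (e 0).elim0

/-- A circuit on no wires is empty. [folklore] -/
theorem gates_eq_nil_of_zero {I : QSimSignInstance} (h : I.n = 0) : I.circuit.gates = [] := by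
  obtain ⟨n, ⟨gs⟩⟩ := I
  change n = 0 at h; subst h
  cases gs with
  | nil => rfl
  | cons g _ => exact (qGate_zero_elim g).elim

/-- The amplitude of a circuit on no wires is `1`. [folklore] -/
theorem amplitude_of_zero {I : QSimSignInstance} (h : I.n = 0) : I.amplitude = 1 := by
  have hg := gates_eq_nil_of_zero h
  obtain ⟨n, ⟨gs⟩⟩ := I
  change gs = [] at hg; subst hg
  exact signAmplitude_nil

/-- The trivial instance `⟨4, ε, 3, 10, 4⟩` is a yes-instance (`ratio = 1`). [folklore] -/
theorem trivial_mem_yesSet : ((4, [], 3, 10, 4) : RawJonesInstance) ∈ RawJonesInstance.yesSet := by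
  refine ⟨⟨⟨2, rfl⟩, by norm_num, by simp, by norm_num, by norm_num⟩, ?_⟩
  have hb : RawJonesInstance.toBraidWord ((4, [], 3, 10, 4) : RawJonesInstance) = [] := rfl
  rw [hb, ajlRatio_eq_norm (by norm_num) ⟨2, rfl⟩ (by norm_num), ajlBraidMatrix_eq]
  simp only [List.map_nil, List.prod_nil, Matrix.one_apply_eq, norm_one]
  change ((3 : ℕ) : ℝ) / ((10 : ℕ) : ℝ) + 1 / ((4 : ℕ) : ℝ) ≤ 1
  norm_num

/-- The braid word of a raw instance whose word is a genuine braid word. [folklore] -/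
theorem toBraidWord_map_val {N : ℕ} (b : BraidWord N) (p q r : ℕ) :
    RawJonesInstance.toBraidWord ((N, b.map (fun g => ((g.1 : ℕ), g.2)), p, q, r) : RawJonesInstance) = b := by
  change (b.map fun g => ((g.1 : ℕ), g.2)).filterMap (fun g => if h : g.1 < N - 1 then some (⟨g.1, h⟩, g.2) else none) = b
  rw [List.filterMap_map]
  induction b with
  | nil => rfl
  | cons g b ih =>
    rw [List.filterMap_cons]
    have : ((fun g : ℕ × Bool => if h : g.1 < N - 1 then some ((⟨g.1, h⟩ : Fin (N - 1)), g.2) else none) ∘ fun g : Fin (N - 1) × Bool => ((g.1 : ℕ), g.2)) g =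
        some g := by simp [g.1.isLt]
    rw [this]; exact congrArg _ ih

/-- The instance map on a nonempty register, unfolded. [folklore] -/
theorem instanceMap_of_pos (P : CompilerParams) {I : QSimSignInstance} (h : I.n ≠ 0) :
    instanceMap P I = (I.n * 4, (reductionBraid P I.circuit.gates).map (fun g => ((g.1 : ℕ), g.2)), 3, 10, 4) := by
  rw [instanceMap, instanceMapB, if_neg h, reductionWordNatB_eq P le_rfl, map_val_reductionBraid]

/-- Validity of the image of a nonempty register. [folklore] -/
theorem isValid_image (P : CompilerParams) {n : ℕ} (hn : n ≠ 0) (gs : List (QGate hSign n)) :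
    RawJonesInstance.IsValid ((n * 4, (reductionBraid P gs).map (fun g => ((g.1 : ℕ), g.2)), 3, 10, 4) : RawJonesInstance) := by
  refine ⟨⟨n * 2, by ring⟩, by change 2 ≤ n * 4; omega, ?_, by change 1 ≤ 10; norm_num, by change 1 ≤ 4; norm_num⟩
  intro g hg
  obtain ⟨g', _, rfl⟩ := List.mem_map.1 hg
  exact g'.1.isLt

/-- A genuine braid word with ratio `≥ 11/20` gives a yes-instance. [folklore] -/
theorem mem_yesSet_of {N : ℕ} (b : BraidWord N)
    (hv : RawJonesInstance.IsValid ((N, b.map (fun g => ((g.1 : ℕ), g.2)), 3, 10, 4) : RawJonesInstance)) (h : (11 / 20 : ℝ) ≤ ajlRatio 5 N b) :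
    ((N, b.map (fun g => ((g.1 : ℕ), g.2)), 3, 10, 4) : RawJonesInstance) ∈ RawJonesInstance.yesSet := by
  refine ⟨hv, ?_⟩
  have e := toBraidWord_map_val b 3 10 4
  unfold RawJonesInstance.threshold RawJonesInstance.prec
  rw [e]
  show ((3 : ℕ) : ℝ) / ((10 : ℕ) : ℝ) + 1 / ((4 : ℕ) : ℝ) ≤ ajlRatio 5 N b
  norm_num; linarith

/-- A genuine braid word with ratio `≤ 3/10` gives a no-instance. [folklore] -/
theorem mem_noSet_of {N : ℕ} (b : BraidWord N)
    (hv : RawJonesInstance.IsValid ((N, b.map (fun g => ((g.1 : ℕ), g.2)), 3, 10, 4) : RawJonesInstance)) (h : ajlRatio 5 N b ≤ 3 / 10) :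
    ((N, b.map (fun g => ((g.1 : ℕ), g.2)), 3, 10, 4) : RawJonesInstance) ∈ RawJonesInstance.noSet := by
  refine ⟨hv, ?_⟩
  have e := toBraidWord_map_val b 3 10 4
  unfold RawJonesInstance.threshold
  rw [e]
  show ajlRatio 5 N b ≤ ((3 : ℕ) : ℝ) / ((10 : ℕ) : ℝ)
  norm_num; linarith

/-- **Yes-instances go to yes-instances.** [cite: AharonovArad2011, Thm. 3.1] -/
theorem instanceMap_yes {P : CompilerParams} (hP : P.Good) {I : QSimSignInstance} (hI : I.IsYes) : instanceMap P I ∈ RawJonesInstance.yesSet := by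
  by_cases h : I.n = 0
  · rw [instanceMap, instanceMapB, if_pos h]; exact trivial_mem_yesSet
  · rw [instanceMap_of_pos P h]
    have hI' : (⟨I.n, ⟨I.circuit.gates⟩⟩ : QSimSignInstance).IsYes := hI
    exact mem_yesSet_of _ (isValid_image P h I.circuit.gates) (ratio_ge_of_isYes_compiled hP (Nat.pos_of_ne_zero h) I.circuit.gates hI')

/-- **No-instances go to no-instances.** [cite: AharonovArad2011, Thm. 3.1] -/
theorem instanceMap_no {P : CompilerParams} (hP : P.Good) {I : QSimSignInstance} (hI : I.IsNo) : instanceMap P I ∈ RawJonesInstance.noSet := by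
  by_cases h : I.n = 0
  · exfalso
    have h1 := hI.2
    rw [amplitude_of_zero h] at h1
    norm_num at h1
  · rw [instanceMap_of_pos P h]
    have hI' : (⟨I.n, ⟨I.circuit.gates⟩⟩ : QSimSignInstance).IsNo := hI
    exact mem_noSet_of _ (isValid_image P h I.circuit.gates) (ratio_le_of_isNo_compiled hP (Nat.pos_of_ne_zero h) I.circuit.gates hI')

/-! ### The reduction and the hardness -/

/-- **QSIM over `{H, Z, CZ, CCZ}` Karp-reduces in polynomial time to the Jones approximation
problem at `e^{2πi/5}`** (Aharonov–Arad Thm. 3.1: encoding in the path model at `k = 5`,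
four strands per qubit, density of the one-qubit and gadget braid groups, polynomial classical
pre-compilation). [cite: AharonovArad2011, Thm. 3.1] [cite: FreedmanLarsenWang2002, main theorem] -/
theorem qSimSign_polyTimeReducible_jonesApprox : qSimSignProblem.PolyTimeReducible jonesApproxProblem := by
  obtain ⟨P, hP⟩ := CompilerParams.exists_good
  obtain ⟨f, hf, hfI⟩ := instanceMap_codeFP hP
  refine ⟨f, hf, ?_, ?_⟩
  · rintro w ⟨I, hI, rfl⟩
    rw [hfI]
    exact (RawJonesInstance.encoding.mem_toLanguage_iff _ _).2 (instanceMap_yes hP hI)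
  · rintro w ⟨I, hI, rfl⟩
    rw [hfI]
    exact (RawJonesInstance.encoding.mem_toLanguage_iff _ _).2 (instanceMap_no hP hI)

/-- **`PromiseBQP`-hardness of the Jones approximation from the hardness of QSIM over the sign
basis** (Aaronson–Ambainis Lemma 24, the tree's `AaronsonAmbainis2018_lemma24_sign_hard`), by
transitivity of Karp reductions. [cite: AharonovArad2011, Thm. 1.1] [cite: AaronsonAmbainis2018, §6 Lemma 24] -/
theorem flw_jonesApproxProblem_hard_of_sign_hard (h : AaronsonAmbainis2018_lemma24_sign_hard) : flw_jonesApproxProblem_hard :=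
  fun Q hQ => PromiseProblem.PolyTimeReducible.trans_holds (h Q hQ) qSimSign_polyTimeReducible_jonesApprox

end Literature.Computability.QuantumComplexity

end
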